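import Mathlib.RingTheory.Ideal.KrullsHeightTheorem
import Mathlib.RingTheory.Filtration
import Mathlib.RingTheory.Ideal.MinimalPrime.Basic
import HarnessLib

/-!
# Crux `PatchingRelPerfect` (stmt-ResolutionOfSingularities-16161), chain W5.2 — F7(β) (β-AX) X3 C-I (M2b) cure §2a, LOCAL ALGEBRA: a function
# whose height-one primes are among given pairwise non-associated prime parameters is a UNIT TIMES A MONOMIAL in them

[OURS · L1 W5.2 · cure plan of record (res-L1-w52-lead-1 g6).]  Replaces the role of NO printed item; NOT a statement of the manuscript under
review (AI-written; AI review weaker than expert review; counted 0).  Def-free, fact-free, pure commutative algebra — the END-extraction engine: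
in a Noetherian local domain `R` with prime elements `z_i ∈ 𝔪` (e.g. part of a regular system of parameters), a non-zero `f` all of whose
height-`≤ 1` primes are among the `(z_i)` is `u · ∏ z_i^{k_i}` with `u` a unit.  No unique factorisation is used: peel off the maximal power of
each `z_i` (Krull΄s intersection theorem) and observe that what is left has no height-one prime (Krull΄s principal ideal theorem), hence is a
unit.  In the cure (§2) it turns «the zero set of `φ̄_c ∘ π` on the carrier lies in the strict normal crossings divisor `X′ ∪ B′|_{G′}`» into
«`φ̄_c ∘ π` is a monomial in the letters».

## References
* H. Matsumura, *Commutative Ring Theory* (1987), Thm. 8.10 (Krull intersection), Thm. 13.5 (principal ideal theorem). [Matsumura1987]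
-/

-- `Summit.<Summit>.<Sub>.Theorems` with `Sub = Summit` (single-conjunct summit, D-0017)
set_option linter.dupNamespace false

noncomputable section

namespace Summit.ResolutionOfSingularities.ResolutionOfSingularities.Theorems.X3LemmaM

open IsLocalRing

variable {R : Type*} [CommRing R] [IsDomain R] [IsNoetherianRing R] [IsLocalRing R]

omit [IsDomain R] in
/-- **Peeling off the maximal power of a prime parameter** (Krull΄s intersection theorem): for `z ∈ 𝔪` and `f ≠ 0` there are `k` and `f₁` with
`f = z^k · f₁` and `z ∤ f₁`. [cite: Matsumura1987, Thm. 8.10] -/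
theorem exists_eq_pow_mul_not_dvd {z : R} (hz : z ∈ maximalIdeal R) {f : R} (hf : f ≠ 0) :
    ∃ (k : ℕ) (f₁ : R), f = z ^ k * f₁ ∧ ¬ z ∣ f₁ := by
  classical
  have hex : ∃ n : ℕ, ¬ z ^ (n + 1) ∣ f := by
    by_contra h
    push Not at h
    have hmem : f ∈ ⨅ n : ℕ, (Ideal.span {z}) ^ n := by
      refine Ideal.mem_iInf.mpr fun n => ?_
      rw [Ideal.span_singleton_pow]
      exact Ideal.mem_span_singleton.mpr ((pow_dvd_pow z (Nat.le_succ n)).trans (h n))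
    have hne : Ideal.span {z} ≠ ⊤ := fun htop =>
      (maximalIdeal.isMaximal R).ne_top (top_le_iff.mp (htop ▸ (Ideal.span_le.mpr (Set.singleton_subset_iff.mpr hz))))
    rw [Ideal.iInf_pow_eq_bot_of_isLocalRing _ hne] at hmem
    exact hf hmem
  set k := Nat.find hex with hk
  have hk1 : ¬ z ^ (k + 1) ∣ f := Nat.find_spec hex
  have hk0 : z ^ k ∣ f := by
    rcases Nat.eq_zero_or_pos k with h0 | hpos
    · rw [h0, pow_zero]; exact one_dvd f
    · have := Nat.find_min hex (m := k - 1) (by omega)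
      push Not at this
      rwa [Nat.sub_add_cancel hpos] at this
  obtain ⟨f₁, hf₁⟩ := hk0
  refine ⟨k, f₁, hf₁, fun hdvd => hk1 ?_⟩
  rw [hf₁, pow_succ]
  exact mul_dvd_mul_left _ hdvd

omit [IsLocalRing R] in
/-- In a Noetherian domain, a prime of height `≤ 1` that contains a non-zero prime ideal `𝔮` equals `𝔮`. [folklore] -/
theorem eq_of_prime_le_of_height_le_one {𝔭 𝔮 : Ideal R} [𝔭.IsPrime] [𝔮.IsPrime] (hq0 : 𝔮 ≠ ⊥) (hle : 𝔮 ≤ 𝔭) (h1 : 𝔭.height ≤ 1) :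
    𝔮 = 𝔭 := by
  have h2 : (1 : ℕ∞) ≤ 𝔮.height := by
    rw [Order.one_le_iff_ne_zero, Ne, Ideal.height_eq_zero_iff_eq_bot]
    exact hq0
  exact Ideal.eq_of_le_of_height_le (I := 𝔮) (J := 𝔭) hle (h1.trans h2)

omit [IsDomain R] in
/-- [OURS · L1 W5.2 · cure §2a] **UNIT TIMES MONOMIAL**, finset form.  `R` a Noetherian local domain, `z : ι → R` prime elements of `𝔪`, and
`f ≠ 0` such that every prime of height `≤ 1` containing `f` is `(z_i)` for some `i ∈ s`: then `f = u · ∏_{i ∈ s} z_i^{k_i}` with `u` a unit.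
[cite: Matsumura1987, Thm. 8.10, Thm. 13.5] -/
theorem exists_isUnit_mul_prod_pow {ι : Type*} [DecidableEq ι] (z : ι → R) (hzm : ∀ i, z i ∈ maximalIdeal R) :
    ∀ (s : Finset ι) {f : R}, f ≠ 0 →
      (∀ 𝔭 : Ideal R, 𝔭.IsPrime → f ∈ 𝔭 → 𝔭.height ≤ 1 → ∃ i ∈ s, 𝔭 = Ideal.span {z i}) →
      ∃ (k : ι → ℕ) (u : R), IsUnit u ∧ f = u * ∏ i ∈ s, z i ^ k i := by
  intro s
  induction s using Finset.induction with
  | empty =>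
    intro f hf H
    refine ⟨fun _ => 0, f, ?_, by simp⟩
    by_contra hu
    have hfm : f ∈ maximalIdeal R := (IsLocalRing.mem_maximalIdeal f).mpr (mem_nonunits_iff.mpr hu)
    obtain ⟨𝔭, h𝔭, -⟩ := Ideal.exists_minimalPrimes_le (show Ideal.span {f} ≤ maximalIdeal R from
      (Ideal.span_singleton_le_iff_mem _).mpr hfm)
    haveI := h𝔭.1.1
    have h1 : 𝔭.height ≤ 1 := Ideal.height_le_one_of_isPrincipal_of_mem_minimalPrimes (Ideal.span {f}) 𝔭 h𝔭
    obtain ⟨i, hi, -⟩ := H 𝔭 h𝔭.1.1 (h𝔭.1.2 (Ideal.mem_span_singleton_self f)) h1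
    simp at hi
  | insert a s ha ih =>
    intro f hf H
    obtain ⟨k, f₁, hff₁, hndvd⟩ := exists_eq_pow_mul_not_dvd (hzm a) hf
    have hf₁ : f₁ ≠ 0 := by rintro rfl; exact hf (by rw [hff₁, mul_zero])
    -- the height-one primes of `f₁` are among the `(z_i)`, `i ∈ s`
    have H₁ : ∀ 𝔭 : Ideal R, 𝔭.IsPrime → f₁ ∈ 𝔭 → 𝔭.height ≤ 1 → ∃ i ∈ s, 𝔭 = Ideal.span {z i} := by
      intro 𝔭 h𝔭 hf₁𝔭 h1
      have hf𝔭 : f ∈ 𝔭 := by rw [hff₁]; exact Ideal.mul_mem_left _ _ hf₁𝔭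
      obtain ⟨i, hi, rfl⟩ := H 𝔭 h𝔭 hf𝔭 h1
      rcases Finset.mem_insert.mp hi with rfl | hi'
      · exact absurd (Ideal.mem_span_singleton.mp hf₁𝔭) hndvd
      · exact ⟨i, hi', rfl⟩
    obtain ⟨k', u, hu, hf₁eq⟩ := ih hf₁ H₁
    refine ⟨Function.update k' a k, u, hu, ?_⟩
    rw [Finset.prod_insert ha, Function.update_self, hff₁, hf₁eq]
    have : ∏ i ∈ s, z i ^ Function.update k' a k i = ∏ i ∈ s, z i ^ k' i := by
      refine Finset.prod_congr rfl fun i hi => ?_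
      rw [Function.update_of_ne (fun h : i = a => ha (h ▸ hi))]
    rw [this]; ring

/-- [OURS · L1 W5.2 · cure §2a] **UNIT TIMES MONOMIAL** — the form used by the END extraction: `z : ι → R` (finite `ι`) prime elements of `𝔪`,
`f ≠ 0`, and every NON-ZERO prime containing `f` of height `≤ 1` contains SOME `z_i` (geometrically: the zero set of `f` near the point lies in
`⋃ V(z_i)`); then `f = u · ∏ z_i^{k_i}`, `u` a unit. [cite: Matsumura1987, Thm. 8.10, Thm. 13.5] -/
theorem exists_isUnit_mul_prod_pow_of_forall_prime {ι : Type*} [Fintype ι] [DecidableEq ι] (z : ι → R)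
    (hzm : ∀ i, z i ∈ maximalIdeal R) (hzp : ∀ i, Prime (z i)) {f : R} (hf : f ≠ 0)
    (H : ∀ 𝔭 : Ideal R, 𝔭.IsPrime → 𝔭 ≠ ⊥ → f ∈ 𝔭 → 𝔭.height ≤ 1 → ∃ i, z i ∈ 𝔭) :
    ∃ (k : ι → ℕ) (u : R), IsUnit u ∧ f = u * ∏ i, z i ^ k i := by
  refine exists_isUnit_mul_prod_pow z hzm Finset.univ hf fun 𝔭 h𝔭 hf𝔭 h1 => ?_
  have h𝔭0 : 𝔭 ≠ ⊥ := fun h => hf (by rw [h] at hf𝔭; exact (Ideal.mem_bot).mp hf𝔭)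
  obtain ⟨i, hi⟩ := H 𝔭 h𝔭 h𝔭0 hf𝔭 h1
  refine ⟨i, Finset.mem_univ i, ?_⟩
  haveI : (Ideal.span {z i}).IsPrime := (Ideal.span_singleton_prime (hzp i).ne_zero).mpr (hzp i)
  exact (eq_of_prime_le_of_height_le_one (𝔭 := 𝔭) (𝔮 := Ideal.span {z i})
    (by rw [Ne, Ideal.span_singleton_eq_bot]; exact (hzp i).ne_zero)
    ((Ideal.span_singleton_le_iff_mem _).mpr hi) h1).symm

end Summit.ResolutionOfSingularities.ResolutionOfSingularities.Theorems.X3LemmaM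

end
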